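import Summits.BirchSwinnertonDyer.Rank1Residual.P2.KrizLiCubeSumThirteenCurve
import Summits.BirchSwinnertonDyer.Rank1Residual.P2.KrizLiSmallCMBase
import HarnessLib

/-!
# Cell `bsd-print-cf2` (D-0131 (2) PRINT TIER, leaf CornerF @ `p = 2`), prover p3 «cube sums» — the BY-NAME
# SLICE cut by the Kriz–Li quadratic-twist family of the Sylvester cube-sum class `x³ + y³ = 13` (base
# `4563b1`, Heegner field `ℚ(√−23)`), the (★)-datum DISPLAYED

HONEST FRAMING. The leaf `Summit.BirchSwinnertonDyer.WAllCornerFTwo` and crux `InertJZeroOfFacts` (20671) are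
OPEN AS CLASSES; nothing class-wide is closed here; no named fact is introduced; nothing is asserted. This
file is the `(4563b1, ℚ(√−23))` FIBRE of the generic Kriz–Li door (`P2/KrizLiSmallCMBase{Transport,}.lean`,
aside 21366 `InertKrizLiStarDoorOfFactsPlus` of route PrintCf2): for every `d ∈ 𝒩(4563b1, ℚ(√−23))` (Def 4.1:
`d ≡ 1 (mod 4)`, `|d|` a square-free product of primes `ℓ ∉ {2, 3, 13}` with `(−23/ℓ) = 1` and `a_ℓ` odd —
lit §14.4: `ℓ ∈ {31, 127, 151, 163, 193, 211, 271, 307, 397, 409, 439, 487, …}`) with `χ_d(−N) = 1`, EVERY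
globally minimal `W'` `ℚ`-isogenous to `4563b1^{(d)}` or to `4563b1^{(−23d)}` — equivalently to the
quadratic twist `C₁₃^{(d)}` / `C₁₃^{(−23d)}` of the cube-sum curve `x³ + y³ = 13` (`isIsogenous_cubeSumCurve_thirteen`)
— satisfies `BSD(W', 2)`, GRANTED BY NAME the seven facts `hKL h33 hS31 hBF hmod hGZK hCassels` (five in
𝔅_inert, two = asides 20767/20768) AND the DISPLAYED (★)-datum `hSD : P2.HasKrizLiStarDatum curve4563b1
(sqrtField (−23))`. That datum is NOT in print (Kriz–Li's Table 1 / Rem 6.3 list only `243a1` among CM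
curves); it is a CERTIFICATE: lit g5 kit j286962 (exact): the Heegner trace over `ℚ(√−23)` is the RATIONAL
point `P_K = (−14/9, −181/27) = −((273/4, 4507/8) + (0, 6))`, Heegner index `1`, `v₂(3·log_ω P_K) = 1` under
both embeddings ⇒ (★) TRUE (lit g2 j282459 interval-grade, same verdict). Currency of every closure below:
LITERAL-by-name((★)-display). The rank-one members are the `W' ~ C₁₃^{(d)}` (Thm 4.3), the `C₁₃^{(−23d)}`
side has analytic rank `0`.

Beyond print: NO as a method (Kriz–Li's theorem); as COVERAGE it is the first infinite family of `BSD(·,2)`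
seeded by a Sylvester cube-sum curve `C_p` (`p ≡ 4, 7 (mod 9)`) — the QUADRATIC twists of `C₁₃`; the
CUBIC-twist family `{C_p}` itself (seat p3's sentence) stays OPEN at `2`: Hu–Shu–Yin 2019 p. 2 «for the
primes ℓ = 2, 3 there are no results known», Cai–Shu–Tian 2017 Thm 1.2 excludes `ℓ ∣ 2p`, Kezuka–Li 2020 is
`Ш[2]` only, and Kriz–Li need `BSD(2)` of the base as INPUT (arXiv:1606.03172 Cor. 4.2 / §5.3), available by
name only for `N < 5000` (Miller), i.e. for `C₇, C₄₉` (`N = 1323`), `C₁₃, C₁₆₉` (`N = 4563`) and `C₉ = 243a1`.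

References: [KrizLi2019] Thm 5.1 (2), Thm 4.3, Def 4.1, §6 Ex. 6.2, Table 1, Rem 6.3; [CreutzMiller2012] Thm 1.1;
[BurungaleFlach2024] Thm 1.1, Cor 2; [MilneADT2006] I.7.3; [HuShuYin2019] Thm 1.3, p. 2; [CaiShuTian2017] Thm 1.2;
[DasguptaVoight2018] Thm 1.2.1; lit DOSSIER §14.4/§14.6, STATUS 2026-08-27T18:37Z (lit g5 certificates).
-/

noncomputable section

open scoped Classical

open WeierstrassCurve NumberField Literature.NumberTheory.EllipticCurves
  Literature.NumberTheory.EllipticCurves.Rank1Residual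
  Literature.NumberTheory.EllipticCurves.ModularForms
  Literature.NumberTheory.EllipticCurves.HuShuYin2019
  Summit.BirchSwinnertonDyer.Rank1Residual

set_option autoImplicit false

namespace Summit.BirchSwinnertonDyer.Rank1Residual.P2

/-! ## §0 Field-generic form: ANY Heegner field `K` of `4563b1` with a (★)-datum -/

/-- **The Heegner hypothesis for `(4563b1, K)` from two Kronecker symbols**: if `(d_K/3) = (d_K/13) = 1` then every
prime of `N(E) ∣ 3³·13²` splits in the quadratic field `K` (lit g5 certified (★) at `d_K ∈ {−23, −95, −191, −263,
−287, −311, −407, −503, −599, −623}`, all of this shape). [cite: KrizLi2019, Thm. 5.1 hypothesis "Heegner hypothesis for N"]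
[cite: Marcus1977, Ch. 3 Thm. 25] -/
theorem satisfiesHeegnerHypothesis_curve4563b1_of_jacobiSym {K : Type} [Field K] [NumberField K]
    (h2 : Module.finrank ℚ K = 2) (h3 : jacobiSym (NumberField.discr K) 3 = 1)
    (h13 : jacobiSym (NumberField.discr K) 13 = 1) :
    SatisfiesHeegnerHypothesis (curve4563b1.conductorNorm ℤ) K := by
  have h : SatisfiesHeegnerHypothesis (3 ^ 3 * 13 ^ 2) K := by
    rw [satisfiesHeegnerHypothesis_iff_kronecker _ K h2]
    intro q hq hqN
    rcases (Nat.Prime.dvd_mul hq).mp hqN with h | h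
    · obtain rfl := (Nat.prime_dvd_prime_iff_eq hq Nat.prime_three).mp (hq.dvd_of_dvd_pow h)
      exact ⟨fun h => absurd h (by norm_num), fun _ => h3⟩
    · obtain rfl := (Nat.prime_dvd_prime_iff_eq hq (by norm_num)).mp (hq.dvd_of_dvd_pow h)
      exact ⟨fun h => absurd h (by norm_num), fun _ => h13⟩
  exact h.of_dvd (by simpa using conductorNorm_curve4563b1_dvd)

/-- **`BSD(W', 2)` on the Kriz–Li family of `4563b1` over ANY Heegner field `K`** (imaginary quadratic with the
Heegner hypothesis for `N(E)`, e.g. via `satisfiesHeegnerHypothesis_curve4563b1_of_jacobiSym`) carrying a DISPLAYED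
(★)-datum `hSD : HasKrizLiStarDatum curve4563b1 K`: for `d ∈ 𝒩(4563b1, K)` with `χ_d(−N) = 1` and every globally
minimal `W'` `ℚ`-isogenous to `4563b1^{(d)}` or `4563b1^{(d·d_K)}`. Each certified field (lit §14.6 / g5: ten with
`|d_K| ≤ 800`) is a NEW family (new primes `ℓ` split in `K`, new partners). [cite: KrizLi2019, Thm. 5.1 (2) and Thm. 4.3]
[cite: CreutzMiller2012, Thm. 1.1] [cite: BurungaleFlach2024, Thm. 1.1 and Cor. 2] [cite: MilneADT2006, Thm. I.7.3] -/
theorem bsdp_two_of_isIsogenous_twist_curve4563b1_of_field (hKL : KrizLi2019.thm112_bsdTwo_twist)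
    (h33 : KrizLi2019.thm33_rank_twist) (hS31 : bsdTriple_of_analyticRank_le_one_of_conductor_lt)
    (hBF : bsdTriple_of_hasCM_of_L_one_ne_zero) (hmod : hasEntireLFunction_rat)
    (hGZK : rank_eq_analyticRank_of_analyticRank_le_one) (hCassels : bsdRHS_eq_of_isIsogenous)
    (K : Type) [Field K] [NumberField K] (hK : IsImaginaryQuadratic K)
    (hH : SatisfiesHeegnerHypothesis (curve4563b1.conductorNorm ℤ) K) (hSD : HasKrizLiStarDatum curve4563b1 K)
    {d : ℤ} (hd : KrizLi2019.InN curve4563b1 K d)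
    (hsign : Int.sign d * jacobiSym (curve4563b1.conductorNorm ℤ) d.natAbs = 1)
    (W' : WeierstrassCurve ℚ) [W'.IsElliptic] [W'.IsGloballyMinimal]
    (hiso : IsIsogenous W' (curve4563b1.quadraticTwist (d : ℚ)) ∨
      IsIsogenous W' (curve4563b1.quadraticTwist ((d * NumberField.discr K : ℤ) : ℚ))) : BSDp W' 2 :=
  bsdp_two_of_isIsogenous_twist_of_hasKrizLiStarDatum curve4563b1 hKL h33 hS31 hBF hmod hGZK hCassels
    hasCM_curve4563b1 conductorNorm_curve4563b1_lt one_le_mordellWeilRank_curve4563b1 twoTorsion_curve4563b1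
    odd_localTamagawaNumber_two_curve4563b1 K hK hH hSD hd hsign W' hiso

/-- **`ord_{s=1} L(4563b1, s) = 1`** from a (★)-datum over ANY Heegner field. [cite: KrizLi2019, Thm. 4.3 (FMS)]
[cite: BurungaleFlach2024, Cor. 2] -/
theorem analyticRank_curve4563b1_of_field (h33 : KrizLi2019.thm33_rank_twist)
    (hBF : bsdTriple_of_hasCM_of_L_one_ne_zero) (hmod : hasEntireLFunction_rat)
    (K : Type) [Field K] [NumberField K] (hK : IsImaginaryQuadratic K)
    (hH : SatisfiesHeegnerHypothesis (curve4563b1.conductorNorm ℤ) K) (hSD : HasKrizLiStarDatum curve4563b1 K) :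
    curve4563b1.analyticRank = 1 :=
  analyticRank_eq_one_of_hasKrizLiStarDatum curve4563b1 h33 hBF hmod hasCM_curve4563b1
    one_le_mordellWeilRank_curve4563b1 twoTorsion_curve4563b1 K hK hH hSD

/-! ## §1 The base pair granted the (★)-display: `r_an(4563b1) = 1`, `BSD(4563b1, 2)`, `BSD(4563b1^{(−23)}, 2)` -/

/-- **`ord_{s=1} L(4563b1, s) = 1`** granted Thm 4.3 (`h33`), Burungale–Flach (`hBF`), modularity (`hmod`) and
the DISPLAYED (★)-datum over `ℚ(√−23)` (`hSD`): Thm 4.3 at `d = 1` gives `≤ 1`, the kernel point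
`(−14/9, 154/27)` of infinite order gives `≠ 0`. [cite: KrizLi2019, Thm. 4.3 (FMS)] [cite: BurungaleFlach2024, Cor. 2]
[cite: Cremona1997, Table 1 (4563b1: r = 1)] -/
theorem analyticRank_curve4563b1 (h33 : KrizLi2019.thm33_rank_twist) (hBF : bsdTriple_of_hasCM_of_L_one_ne_zero)
    (hmod : hasEntireLFunction_rat) (hSD : HasKrizLiStarDatum curve4563b1 (sqrtField (-23))) :
    curve4563b1.analyticRank = 1 :=
  analyticRank_curve4563b1_of_field h33 hBF hmod (sqrtField (-23))
    isImaginaryQuadratic_and_discr_sqrtField_neg_twentyThree.1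
    (satisfiesHeegnerHypothesis_curve4563b1 (sqrtField.finrank_eq_two _)
      isImaginaryQuadratic_and_discr_sqrtField_neg_twentyThree.2) hSD

/-- **`BSD(4563b1, 2)`** (Creutz–Miller `hS31`: `r_an = 1`, `N ∣ 4563 < 5000`) granted the (★)-display for the rank.
[cite: CreutzMiller2012, Thm. 1.1] [cite: KrizLi2019, Rem. 5.2] -/
theorem bsdp_two_curve4563b1 (h33 : KrizLi2019.thm33_rank_twist)
    (hS31 : bsdTriple_of_analyticRank_le_one_of_conductor_lt) (hBF : bsdTriple_of_hasCM_of_L_one_ne_zero)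
    (hmod : hasEntireLFunction_rat) (hSD : HasKrizLiStarDatum curve4563b1 (sqrtField (-23))) :
    BSDp curve4563b1 2 :=
  bsdp_two_of_analyticRank_le_one_of_conductor_lt_5000 hS31 curve4563b1
    (analyticRank_curve4563b1 h33 hBF hmod hSD).le conductorNorm_curve4563b1_lt

/-! ## §2 The family: `BSD(W', 2)` on the `ℚ`-isogeny classes of `4563b1^{(d)}`, `4563b1^{(−23d)}`, `d ∈ 𝒩` -/

/-- `d · d_K = −23 · d` as rational numbers (`d_K = −23`). [folklore] -/
theorem cast_mul_discr_sqrtField_neg_twentyThree (d : ℤ) :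
    ((d * NumberField.discr (sqrtField (-23)) : ℤ) : ℚ) = ((-23 * d : ℤ) : ℚ) := by
  rw [isImaginaryQuadratic_and_discr_sqrtField_neg_twentyThree.2]; push_cast; ring

/-- **`2`-PART OF BSD ON THE KRIZ–LI FAMILY OF THE CUBE-SUM CLASS `x³ + y³ = 13`**: granted BY NAME Kriz–Li
Thm 5.1 (2) (`hKL`), Thm 4.3 (`h33`), Creutz–Miller (`hS31`), Burungale–Flach (`hBF`), modularity (`hmod`), GZK
(`hGZK`), Cassels (`hCassels`) and the DISPLAYED (★)-datum at `(4563b1, ℚ(√−23))` (`hSD`, a certificate): for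
every `d ∈ 𝒩(4563b1, ℚ(√−23))` with `χ_d(−N) = 1` and every globally minimal `W'` `ℚ`-isogenous to `4563b1^{(d)}`
or `4563b1^{(−23d)}`, `BSD(W', 2)`. [cite: KrizLi2019, Thm. 5.1 (2) (FMS, VoR p. 30), Thm. 4.3, §6 Ex. 6.2]
[cite: CreutzMiller2012, Thm. 1.1] [cite: BurungaleFlach2024, Thm. 1.1 and Cor. 2] [cite: MilneADT2006, Thm. I.7.3] -/
theorem bsdp_two_of_isIsogenous_twist_curve4563b1 (hKL : KrizLi2019.thm112_bsdTwo_twist)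
    (h33 : KrizLi2019.thm33_rank_twist) (hS31 : bsdTriple_of_analyticRank_le_one_of_conductor_lt)
    (hBF : bsdTriple_of_hasCM_of_L_one_ne_zero) (hmod : hasEntireLFunction_rat)
    (hGZK : rank_eq_analyticRank_of_analyticRank_le_one) (hCassels : bsdRHS_eq_of_isIsogenous)
    (hSD : HasKrizLiStarDatum curve4563b1 (sqrtField (-23)))
    {d : ℤ} (hd : KrizLi2019.InN curve4563b1 (sqrtField (-23)) d)
    (hsign : Int.sign d * jacobiSym (curve4563b1.conductorNorm ℤ) d.natAbs = 1)
    (W' : WeierstrassCurve ℚ) [W'.IsElliptic] [W'.IsGloballyMinimal]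
    (hiso : IsIsogenous W' (curve4563b1.quadraticTwist (d : ℚ)) ∨
      IsIsogenous W' (curve4563b1.quadraticTwist ((-23 * d : ℤ) : ℚ))) : BSDp W' 2 := by
  rw [← cast_mul_discr_sqrtField_neg_twentyThree] at hiso
  exact bsdp_two_of_isIsogenous_twist_curve4563b1_of_field hKL h33 hS31 hBF hmod hGZK hCassels (sqrtField (-23))
    isImaginaryQuadratic_and_discr_sqrtField_neg_twentyThree.1
    (satisfiesHeegnerHypothesis_curve4563b1 (sqrtField.finrank_eq_two _)
      isImaginaryQuadratic_and_discr_sqrtField_neg_twentyThree.2) hSD hd hsign W' hiso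

/-- **The same, phrased on the cube-sum curve**: every globally minimal `W'` `ℚ`-isogenous to the quadratic twist
`C₁₃^{(d)}` or `C₁₃^{(−23d)}` of `x³ + y³ = 13` (`cubeSumCurve 13`), `d ∈ 𝒩`, `χ_d(−N) = 1`, satisfies `BSD(W', 2)`
(isogenies twist: `C₁₃^{(e)} ~ 4563b1^{(e)}`). [cite: KrizLi2019, Thm. 5.1 (2)] [cite: HuShuYin2019, p. 2 (ℓ = 2 open for C_p)] -/
theorem bsdp_two_of_isIsogenous_twist_cubeSum_thirteen (hKL : KrizLi2019.thm112_bsdTwo_twist)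
    (h33 : KrizLi2019.thm33_rank_twist) (hS31 : bsdTriple_of_analyticRank_le_one_of_conductor_lt)
    (hBF : bsdTriple_of_hasCM_of_L_one_ne_zero) (hmod : hasEntireLFunction_rat)
    (hGZK : rank_eq_analyticRank_of_analyticRank_le_one) (hCassels : bsdRHS_eq_of_isIsogenous)
    (hSD : HasKrizLiStarDatum curve4563b1 (sqrtField (-23)))
    {d : ℤ} (hd : KrizLi2019.InN curve4563b1 (sqrtField (-23)) d)
    (hsign : Int.sign d * jacobiSym (curve4563b1.conductorNorm ℤ) d.natAbs = 1)
    (W' : WeierstrassCurve ℚ) [W'.IsElliptic] [W'.IsGloballyMinimal]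
    (hiso : IsIsogenous W' ((cubeSumCurve 13).quadraticTwist (d : ℚ)) ∨
      IsIsogenous W' ((cubeSumCurve 13).quadraticTwist ((-23 * d : ℤ) : ℚ))) : BSDp W' 2 := by
  have hd0 : (d : ℚ) ≠ 0 := cast_ne_zero_of_inN curve4563b1 hd
  have hd0' : ((-23 * d : ℤ) : ℚ) ≠ 0 := by push_cast; exact mul_ne_zero (by norm_num) hd0
  refine bsdp_two_of_isIsogenous_twist_curve4563b1 hKL h33 hS31 hBF hmod hGZK hCassels hSD hd hsign W' ?_
  exact hiso.imp (fun h => h.trans' (isIsogenous_cubeSumCurve_thirteen.quadraticTwist hd0))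
    (fun h => h.trans' (isIsogenous_cubeSumCurve_thirteen.quadraticTwist hd0'))

/-- **The analytic ranks along the family**: `r_an = 1` on the minimal models of `4563b1^{(d)}`, `0` on those
of `4563b1^{(−23d)}`. [cite: KrizLi2019, Thm. 4.3 (FMS) = arXiv Thm. 3.3] -/
theorem analyticRank_of_twist_curve4563b1 (h33 : KrizLi2019.thm33_rank_twist)
    (hBF : bsdTriple_of_hasCM_of_L_one_ne_zero) (hmod : hasEntireLFunction_rat)
    (hSD : HasKrizLiStarDatum curve4563b1 (sqrtField (-23)))
    {d : ℤ} (hd : KrizLi2019.InN curve4563b1 (sqrtField (-23)) d)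
    (hsign : Int.sign d * jacobiSym (curve4563b1.conductorNorm ℤ) d.natAbs = 1)
    (W₁ W₂ : WeierstrassCurve ℚ) [W₁.IsElliptic] [W₁.IsGloballyMinimal] [W₂.IsElliptic] [W₂.IsGloballyMinimal]
    (hW₁ : ∃ C : VariableChange ℚ, C • curve4563b1.quadraticTwist (d : ℚ) = W₁)
    (hW₂ : ∃ C : VariableChange ℚ, C • curve4563b1.quadraticTwist ((-23 * d : ℤ) : ℚ) = W₂) :
    W₁.analyticRank = 1 ∧ W₂.analyticRank = 0 := by
  rw [← cast_mul_discr_sqrtField_neg_twentyThree] at hW₂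
  exact analyticRank_of_twist_of_hasKrizLiStarDatum curve4563b1 h33 hBF hmod hasCM_curve4563b1
    one_le_mordellWeilRank_curve4563b1 twoTorsion_curve4563b1 (sqrtField (-23))
    isImaginaryQuadratic_and_discr_sqrtField_neg_twentyThree.1
    (satisfiesHeegnerHypothesis_curve4563b1 (sqrtField.finrank_eq_two _)
      isImaginaryQuadratic_and_discr_sqrtField_neg_twentyThree.2) hSD hd hsign W₁ W₂ hW₁ hW₂

/-! ## §3 Membership predicate of the fibre and the slice in leaf shape -/

/-- **`W'` is `ℚ`-ISOGENOUS to a Kriz–Li twist of the cube-sum class `x³ + y³ = 13`**: `d ∈ 𝒩(4563b1, ℚ(√−23))`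
with `χ_d(−N) = 1` and a `ℚ`-isogeny `W' ~ 4563b1^{(d)}` or `W' ~ 4563b1^{(−23d)}`. No (★) inside (it is the
display binder of the theorems); a definition with a body (data `d`). [cite: KrizLi2019, Def. 4.1 and Thm. 5.1 (2)] -/
def IsIsogenousToKrizLiCubeSumThirteenTwist (W' : WeierstrassCurve ℚ) : Prop :=
  ∃ d : ℤ, KrizLi2019.InN curve4563b1 (sqrtField (-23)) d ∧
    Int.sign d * jacobiSym (curve4563b1.conductorNorm ℤ) d.natAbs = 1 ∧
    (IsIsogenous W' (curve4563b1.quadraticTwist (d : ℚ)) ∨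
      IsIsogenous W' (curve4563b1.quadraticTwist ((-23 * d : ℤ) : ℚ)))

/-- **EXPLICIT members**: `d > 0`, `d ≡ 1 (mod 12)`, `(d/13) = 1`, `|d|` square-free, every prime `ℓ ∣ d` an
explicit Kriz–Li prime of `4563b1` (`IsKrizLiPrime4563`) — then `d ∈ 𝒩` and `χ_d(−N) = 1` IN THE KERNEL.
[cite: KrizLi2019, Def. 4.1 and Thm. 5.1 (2)] -/
theorem isIsogenousToKrizLiCubeSumThirteenTwist_of_explicit {d : ℤ} (hd0 : 0 < d) (hd12 : d % 12 = 1)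
    (hd13 : jacobiSym d 13 = 1) (hsq : Squarefree d.natAbs)
    (hprimes : ∀ ℓ : ℕ, ℓ.Prime → ℓ ∣ d.natAbs → IsKrizLiPrime4563 ℓ) {W' : WeierstrassCurve ℚ}
    (hiso : IsIsogenous W' (curve4563b1.quadraticTwist (d : ℚ)) ∨
      IsIsogenous W' (curve4563b1.quadraticTwist ((-23 * d : ℤ) : ℚ))) :
    IsIsogenousToKrizLiCubeSumThirteenTwist W' :=
  ⟨d, inN_curve4563b1 (sqrtField.finrank_eq_two _) isImaginaryQuadratic_and_discr_sqrtField_neg_twentyThree.2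
    (by omega) hsq hprimes, sign_mul_jacobiSym_conductorNorm_curve4563b1 hd0 hd12 hd13, hiso⟩

/-- **Granted the (★)-display, the fibre lies in the generic family** (`P2.IsIsogenousToKrizLiTwistOfSmallCMBase`,
the membership of aside 21366's road). [cite: KrizLi2019, Thm. 5.1 (2) (hypothesis list)] -/
theorem isIsogenousToKrizLiTwistOfSmallCMBase_of_cubeSumThirteen
    (hSD : HasKrizLiStarDatum curve4563b1 (sqrtField (-23))) {W' : WeierstrassCurve ℚ}
    (hW' : IsIsogenousToKrizLiCubeSumThirteenTwist W') : IsIsogenousToKrizLiTwistOfSmallCMBase W' := by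
  obtain ⟨d, hd, hsign, hiso⟩ := hW'
  rw [← cast_mul_discr_sqrtField_neg_twentyThree] at hiso
  exact ⟨curve4563b1, inferInstance, inferInstance, inferInstance, hasCM_curve4563b1, conductorNorm_curve4563b1_lt,
    one_le_mordellWeilRank_curve4563b1, twoTorsion_curve4563b1, odd_localTamagawaNumber_two_curve4563b1,
    sqrtField (-23), inferInstance, inferInstance, isImaginaryQuadratic_and_discr_sqrtField_neg_twentyThree.1,
    satisfiesHeegnerHypothesis_curve4563b1 (sqrtField.finrank_eq_two _)
      isImaginaryQuadratic_and_discr_sqrtField_neg_twentyThree.2, hSD, d, hd, hsign, hiso⟩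

/-- **Placement** (unconditional): every member has CM, `2` inert in `K_CM = ℚ(√−3)`, `j = 0`.
[cite: SilvermanAEC2009, Cor. III.9.4 and X.5.4] -/
theorem placement_of_isIsogenousToKrizLiCubeSumThirteenTwist (W' : WeierstrassCurve ℚ) [W'.IsElliptic]
    (hW' : IsIsogenousToKrizLiCubeSumThirteenTwist W') : W'.HasCM ∧ CMInert W' 2 := by
  obtain ⟨d, hd, -, hiso⟩ := hW'
  have hd0 : (d : ℚ) ≠ 0 := cast_ne_zero_of_inN curve4563b1 hd
  have hd0' : ((-23 * d : ℤ) : ℚ) ≠ 0 := by push_cast; exact mul_ne_zero (by norm_num) hd0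
  have key : ∀ {e : ℚ}, e ≠ 0 → IsIsogenous W' (curve4563b1.quadraticTwist e) → W'.HasCM ∧ CMInert W' 2 := by
    intro e he hiso
    haveI := curve4563b1.isElliptic_quadraticTwist he
    have hT : (curve4563b1.quadraticTwist e).HasCM := hasCM_of_smul_twist_of_hasCM hasCM_curve4563b1 he ⟨1, one_smul _ _⟩
    have hcmW : W'.HasCM := X12.hasCM_of_isIsogenous hiso.symm_of_charZero hT
    have hinT : CMInert (curve4563b1.quadraticTwist e) 2 :=
      (cmInert_two_iff_of_hasCM hT).2 (Or.inl (by
        rw [j_quadraticTwist _ he, curve4563b1_j]; simp [cmFieldDiscrOfJ]))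
    exact ⟨hcmW, (X12.cmInert_iff_of_isIsogenous hiso hcmW 2).2 hinT⟩
  rcases hiso with hiso | hiso
  · exact key hd0 hiso
  · exact key hd0' hiso

/-- **SLICE BY NAME in LEAF SHAPE, (★) DISPLAYED**: granted the seven named facts and
`hSD : HasKrizLiStarDatum curve4563b1 (sqrtField (−23))` (certificate), every globally minimal CM curve of analytic
rank one with `2` inert in `K_CM`, `ℚ`-isogenous to a Kriz–Li twist of the cube-sum class `x³ + y³ = 13`,
satisfies `BSD(W, 2)`. Currency LITERAL-by-name((★)-display). [cite: KrizLi2019, Thm. 5.1 (2), Thm. 4.3, §6 Ex. 6.2]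
[cite: CreutzMiller2012, Thm. 1.1] [cite: BurungaleFlach2024, Thm. 1.1 and Cor. 2] [cite: MilneADT2006, Thm. I.7.3] -/
theorem cornerFTwo_krizLiCubeSumThirteen_byName (hKL : KrizLi2019.thm112_bsdTwo_twist)
    (h33 : KrizLi2019.thm33_rank_twist) (hS31 : bsdTriple_of_analyticRank_le_one_of_conductor_lt)
    (hBF : bsdTriple_of_hasCM_of_L_one_ne_zero) (hmod : hasEntireLFunction_rat)
    (hGZK : rank_eq_analyticRank_of_analyticRank_le_one) (hCassels : bsdRHS_eq_of_isIsogenous)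
    (hSD : HasKrizLiStarDatum curve4563b1 (sqrtField (-23))) :
    ∀ (W : WeierstrassCurve ℚ) [W.IsElliptic] [W.IsGloballyMinimal], W.HasCM → W.analyticRank = 1 →
      CMInert W 2 → IsIsogenousToKrizLiCubeSumThirteenTwist W → BSDp W 2 :=
  fun W _ _ _ _ _ hW =>
    bsdp_two_of_isIsogenousToKrizLiTwistOfSmallCMBase hKL h33 hS31 hBF hmod hGZK hCassels W
      (isIsogenousToKrizLiTwistOfSmallCMBase_of_cubeSumThirteen hSD hW)

end Summit.BirchSwinnertonDyer.Rank1Residual.P2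

end
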